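import Mathlib
import Literature.Analysis.FluidPDE.VectorCalculus
import Literature.Analysis.FluidPDE.VorticityCalculus
import Literature.Analysis.FluidPDE.BiotSavartNewtonKernel
import Literature.Analysis.FluidPDE.BiotSavartCurlPair
import Summits.NavierStokesRegularity.NavierStokesRegularity.Theorems.ThreadingFluxCentreJetDefs
import Summits.NavierStokesRegularity.NavierStokesRegularity.Theorems.TypeIQuarterGateScarEnvelopeTypeIForcedTsaiStokesletSelfAdvection
import Summits.NavierStokesRegularity.NavierStokesRegularity.Theorems.ThreadingFluxHorizonTowerProfileCurlT1
import HarnessLib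

/-!
# Crux `PoloidalLiouville` (stmt-NavierStokesRegularity-1222, W1), crux idea «azimuthal-cartan-test» (ns-idea-15 g10, V26):
# bricks for V♯ `LandauVertexFlexibility` — the conformal-derivative witness is analytic and unthreaded

V♯ (sketch v1.3b/c l.330) asks for an analytic solution `(δv, δp)` on `landauTorus` of the linearised steady NS system at the Landau flow
(`c = 2`, axis `e₂`, vertex `0`), unthreaded about `0`, which is not a tilt plus a `J₃`-equivariant field.  The crux note
`Cruxes/PoloidalLiouville/AzimuthalCartanVertexWitness.md` (ns-wall-eng-8 g5) exhibits the witness in closed form — the `ε`-derivative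
of Šverák's conformal family along `f_ε = az + εz³` (arXiv:math/0604550 §3–4):

`θ(x) = (x₀² − x₁²)(10|x| − 8x₂)/((|x| − x₂)²(2|x| − x₂))`, `δv = ∇θ + (6θ/(2|x| − x₂)²)·x`, `δp = 6θ/(2|x| − x₂)² − ⟨∇Φ, ∇θ⟩`,

with 60-digit finite-difference residuals `≤ 1.3e-15`.  This file lands the two S/M clauses of V♯ for this witness, kernel-checked:

* `VertexWitness.curl_grad_add_smul_self` / `inner_curl_grad_add_smul_self` — STRUCTURE LEMMA: for `θ ∈ C²` and `g` differentiable at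
  `x`, `curl (∇θ + g·id)(x) = ∇g(x) × x`, hence `⟪x, curl (∇θ + g·id)(x)⟫ = 0`: every field of the conformal-linearised shape is unthreaded
  about the vertex (tree: local `curl ∇ = 0` `ForcedTsai.curl_gradient_eq_zero_of_contDiffAt`, `ForcedTsai.curl_id_eq_zero`, `curl_smul`,
  `curlCLM_smulRight_innerSL`, `HorizonTower.inner_cross_self_right`);
* `VertexWitness.contDiffAt_theta` — `θ` is `C^ω` (hence analytic, hence `C²`) off the closed ray `{x₀ = x₁ = 0, x₂ ≥ 0}`, i.e. wherever
  `|x| ≠ x₂`; likewise `g = 6θ/(2|x| − x₂)²`;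
* `VertexWitness.analyticAt_witness`, `VertexWitness.inner_curl_witness_eq_zero` — the witness `δv` is real-analytic and unthreaded about `0`
  at every point with `|x| ≠ x₂` (so on `landauTorus`, which misses the axis).

The remaining clauses of V♯ (divergence, the linearised momentum identity — second derivatives of explicit rational–sqrt fields — and the
mode-2 non-equivariance) are NOT proved here (sized L / M in the note).  `LandauVertexFlexibility` stays OPEN as a Lean Prop;
`PoloidalLiouville` (1222) and NS regularity stay OPEN / NOT proved.  `--supports stmt-NavierStokesRegularity-1222 --as helper`; 0 kit.
[folklore]
-/

-- the summit and its single problem share the name (D-0017 nested layout)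
set_option linter.dupNamespace false

noncomputable section

open Set Function Metric
open scoped RealInnerProductSpace
open Literature.Analysis.FluidPDE

namespace Summit.NavierStokesRegularity.NavierStokesRegularity.Theorems.PoloidalLiouville.AzimuthalCartan

open Summit.NavierStokesRegularity.NavierStokesRegularity.Theorems.PoloidalLiouville.CentreJet (E3)
open Summit.NavierStokesRegularity.NavierStokesRegularity.Cruxes.ScarEnvelopeTypeI.ForcedTsai
  (curl_gradient_eq_zero_of_contDiffAt curl_id_eq_zero)
open Summit.NavierStokesRegularity.NavierStokesRegularity.Theorems.PoloidalLiouville.HorizonTower (inner_cross_self_right)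

namespace VertexWitness

/-! ### The structure lemma: `curl (∇θ + g·id) = ∇g × id`, hence unthreaded about the vertex -/

/-- **Structure lemma.**  For `θ` of class `C²` at `x` and `g` differentiable at `x`:
`curl (y ↦ ∇θ(y) + g(y)·y)(x) = ∇g(x) × x` (the gradient part is curl-free by the symmetry of the Hessian; `curl (g·id) = ∇g × id`
since `curl id = 0`). [folklore] -/
theorem curl_grad_add_smul_self {θ g : E3 → ℝ} {x : E3} (hθ : ContDiffAt ℝ 2 θ x) (hg : DifferentiableAt ℝ g x) :
    curl (fun y => gradient θ y + g y • y) x = cross (gradient g x) x := by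
  obtain ⟨hdg, hcurl⟩ := curl_gradient_eq_zero_of_contDiffAt hθ
  have hid : DifferentiableAt ℝ (fun y : E3 => y) x := differentiableAt_id
  have hsm : DifferentiableAt ℝ (fun y : E3 => g y • y) x := hg.smul hid
  rw [curl_add hdg hsm, hcurl, zero_add, curl_smul hg hid, curl_id_eq_zero, smul_zero, zero_add,
    fderiv_eq_innerSL_gradient, curlCLM_smulRight_innerSL]

/-- **Fields of the shape `∇θ + g·id` are unthreaded about the vertex `0`**: `⟪x − 0, curl (∇θ + g·id)(x)⟫ = 0` (the sketch's
`IsUnthreadedOn U 0`, pointwise). [folklore] -/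
theorem inner_curl_grad_add_smul_self {θ g : E3 → ℝ} {x : E3} (hθ : ContDiffAt ℝ 2 θ x) (hg : DifferentiableAt ℝ g x) :
    inner ℝ (x - 0) (curl (fun y => gradient θ y + g y • y) x) = 0 := by
  rw [sub_zero, curl_grad_add_smul_self hθ hg]
  exact inner_cross_self_right _ _

/-- **Fields of the shape `∇θ + g·id` are real-analytic where `θ`, `g` are.** [folklore] -/
theorem analyticAt_grad_add_smul_self {θ g : E3 → ℝ} {x : E3} (hθ : AnalyticAt ℝ θ x) (hg : AnalyticAt ℝ g x) :
    AnalyticAt ℝ (fun y => gradient θ y + g y • y) x := by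
  have h1 : ContDiffAt ℝ (⊤ : WithTop ℕ∞) θ x := hθ.contDiffAt
  have h2 : ContDiffAt ℝ (⊤ : WithTop ℕ∞) (fderiv ℝ θ) x := h1.fderiv_right le_rfl
  have h3 : ContDiffAt ℝ (⊤ : WithTop ℕ∞) (gradient θ) x := by
    have e : gradient θ = fun y => (InnerProductSpace.toDual ℝ E3).symm (fderiv ℝ θ y) := rfl
    rw [e]
    exact (InnerProductSpace.toDual ℝ E3).symm.toContinuousLinearEquiv.contDiff.contDiffAt.comp x h2
  exact h3.analyticAt.add (hg.smul analyticAt_id)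

/-! ### The conformal-derivative witness at the Landau vertex (c = 2, axis e₂) -/

/-- Off the closed ray `{x₀ = x₁ = 0, x₂ ≥ 0}` one has `|x| ≠ x₂` ⇒ `x ≠ 0`, `|x| − x₂ ≠ 0`, `2|x| − x₂ ≠ 0`. [folklore] -/
theorem denoms_ne_zero {x : E3} (hx : ‖x‖ ≠ x 2) : x ≠ 0 ∧ ‖x‖ - x 2 ≠ 0 ∧ 2 * ‖x‖ - x 2 ≠ 0 := by
  have hle : x 2 ≤ ‖x‖ := (le_abs_self _).trans (by simpa using PiLp.norm_apply_le x 2)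
  refine ⟨fun h0 => hx ?_, sub_ne_zero.2 hx, ?_⟩
  · rw [h0]; simp
  · intro h
    have : ‖x‖ = 0 := by linarith [norm_nonneg x]
    rw [norm_eq_zero] at this
    apply hx; rw [this]; simp

/-- **`θ` is `C^ω` off the ray** (`θ = (x₀² − x₁²)(10|x| − 8x₂)/((|x| − x₂)²(2|x| − x₂))`; `|·|` is analytic off `0`). [folklore] -/
theorem contDiffAt_theta {x : E3} (hx : ‖x‖ ≠ x 2) {n : WithTop ℕ∞} :
    ContDiffAt ℝ n (fun y : E3 => (y 0 ^ 2 - y 1 ^ 2) * (10 * ‖y‖ - 8 * y 2) / ((‖y‖ - y 2) ^ 2 * (2 * ‖y‖ - y 2))) x := by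
  obtain ⟨h0, h1, h2⟩ := denoms_ne_zero hx
  have hn : ContDiffAt ℝ n (fun y : E3 => ‖y‖) x := contDiffAt_norm ℝ h0
  have hc : ∀ i : Fin 3, ContDiffAt ℝ n (fun y : E3 => y i) x := fun i =>
    (EuclideanSpace.proj i : E3 →L[ℝ] ℝ).contDiff.contDiffAt
  exact ((((hc 0).pow 2).sub ((hc 1).pow 2)).mul ((contDiffAt_const.mul hn).sub (contDiffAt_const.mul (hc 2)))).div
    (((hn.sub (hc 2)).pow 2).mul ((contDiffAt_const.mul hn).sub (hc 2))) (mul_ne_zero (pow_ne_zero 2 h1) h2)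

/-- **`g = 6θ/(2|x| − x₂)²` is `C^ω` off the ray.** [folklore] -/
theorem contDiffAt_g {x : E3} (hx : ‖x‖ ≠ x 2) {n : WithTop ℕ∞} :
    ContDiffAt ℝ n (fun y : E3 => 6 * ((y 0 ^ 2 - y 1 ^ 2) * (10 * ‖y‖ - 8 * y 2) / ((‖y‖ - y 2) ^ 2 * (2 * ‖y‖ - y 2))) /
      (2 * ‖y‖ - y 2) ^ 2) x := by
  obtain ⟨h0, -, h2⟩ := denoms_ne_zero hx
  have hn : ContDiffAt ℝ n (fun y : E3 => ‖y‖) x := contDiffAt_norm ℝ h0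
  have hc2 : ContDiffAt ℝ n (fun y : E3 => y 2) x := (EuclideanSpace.proj (2 : Fin 3) : E3 →L[ℝ] ℝ).contDiff.contDiffAt
  exact (contDiffAt_const.mul (contDiffAt_theta hx)).div (((contDiffAt_const.mul hn).sub hc2).pow 2) (pow_ne_zero 2 h2)

/-- **The witness `δv = ∇θ + g·id` is real-analytic off the ray** (in particular on `landauTorus`, which misses the axis). [folklore] -/
theorem analyticAt_witness {x : E3} (hx : ‖x‖ ≠ x 2) :
    AnalyticAt ℝ (fun y : E3 =>
      gradient (fun y : E3 => (y 0 ^ 2 - y 1 ^ 2) * (10 * ‖y‖ - 8 * y 2) / ((‖y‖ - y 2) ^ 2 * (2 * ‖y‖ - y 2))) y +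
        (6 * ((y 0 ^ 2 - y 1 ^ 2) * (10 * ‖y‖ - 8 * y 2) / ((‖y‖ - y 2) ^ 2 * (2 * ‖y‖ - y 2))) / (2 * ‖y‖ - y 2) ^ 2) • y) x :=
  analyticAt_grad_add_smul_self ((contDiffAt_theta hx (n := ⊤)).analyticAt) ((contDiffAt_g hx (n := ⊤)).analyticAt)

/-- **The witness is unthreaded about the vertex off the ray**: `⟪x − 0, curl δv (x)⟫ = 0`. [folklore] -/
theorem inner_curl_witness_eq_zero {x : E3} (hx : ‖x‖ ≠ x 2) :
    inner ℝ (x - 0) (curl (fun y : E3 =>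
      gradient (fun y : E3 => (y 0 ^ 2 - y 1 ^ 2) * (10 * ‖y‖ - 8 * y 2) / ((‖y‖ - y 2) ^ 2 * (2 * ‖y‖ - y 2))) y +
        (6 * ((y 0 ^ 2 - y 1 ^ 2) * (10 * ‖y‖ - 8 * y 2) / ((‖y‖ - y 2) ^ 2 * (2 * ‖y‖ - y 2))) / (2 * ‖y‖ - y 2) ^ 2) • y) x) = 0 :=
  inner_curl_grad_add_smul_self (contDiffAt_theta hx (n := 2))
    ((contDiffAt_g hx (n := 1)).differentiableAt one_ne_zero)

/-- **The witness pressure `δp = g − ⟨∇Φ, ∇θ⟩` is real-analytic off the ray** (`Φ = log(3|x|²/(2|x| − x₂)²)`, the Landau conformal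
potential; gradients of `C^ω` functions are `C^ω`, and so is their inner product). [folklore] -/
theorem analyticAt_witnessPressure {x : E3} (hx : ‖x‖ ≠ x 2) :
    AnalyticAt ℝ (fun y : E3 =>
      6 * ((y 0 ^ 2 - y 1 ^ 2) * (10 * ‖y‖ - 8 * y 2) / ((‖y‖ - y 2) ^ 2 * (2 * ‖y‖ - y 2))) / (2 * ‖y‖ - y 2) ^ 2 -
        inner ℝ (gradient (fun y : E3 => Real.log (3 * ‖y‖ ^ 2 / (2 * ‖y‖ - y 2) ^ 2)) y)
          (gradient (fun y : E3 => (y 0 ^ 2 - y 1 ^ 2) * (10 * ‖y‖ - 8 * y 2) / ((‖y‖ - y 2) ^ 2 * (2 * ‖y‖ - y 2))) y)) x := by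
  obtain ⟨h0, -, h2⟩ := denoms_ne_zero hx
  have hn : ContDiffAt ℝ (⊤ : WithTop ℕ∞) (fun y : E3 => ‖y‖) x := contDiffAt_norm ℝ h0
  have hc2 : ContDiffAt ℝ (⊤ : WithTop ℕ∞) (fun y : E3 => y 2) x :=
    (EuclideanSpace.proj (2 : Fin 3) : E3 →L[ℝ] ℝ).contDiff.contDiffAt
  -- gradients of `C^ω` maps are `C^ω`
  have hgrad : ∀ {φ : E3 → ℝ}, ContDiffAt ℝ (⊤ : WithTop ℕ∞) φ x → ContDiffAt ℝ (⊤ : WithTop ℕ∞) (gradient φ) x := by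
    intro φ hφ
    have e : gradient φ = fun y => (InnerProductSpace.toDual ℝ E3).symm (fderiv ℝ φ y) := rfl
    rw [e]
    exact (InnerProductSpace.toDual ℝ E3).symm.toContinuousLinearEquiv.contDiff.contDiffAt.comp x (hφ.fderiv_right le_rfl)
  have hΦ : ContDiffAt ℝ (⊤ : WithTop ℕ∞) (fun y : E3 => Real.log (3 * ‖y‖ ^ 2 / (2 * ‖y‖ - y 2) ^ 2)) x := by
    refine ((contDiffAt_const.mul (hn.pow 2)).div (((contDiffAt_const.mul hn).sub hc2).pow 2) (pow_ne_zero 2 h2)).log ?_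
    have hr : 0 < ‖x‖ := norm_pos_iff.2 h0
    have hD : 0 < (2 * ‖x‖ - x 2) ^ 2 := by positivity
    exact (div_pos (by positivity) hD).ne'
  have h := ((contDiffAt_g hx (n := ⊤)).sub ((hgrad hΦ).inner ℝ (hgrad (contDiffAt_theta hx (n := ⊤))))).analyticAt
  exact h

/-! ### The clauses of V♯ this file settles, on the solid torus of the sketch (δ-unfolded `landauTorus`) -/

/-- Points of the sketch's `landauTorus` (axial coordinates within sup-distance `1` of `(3,4)`) are off the axis: `|x| ≠ x₂`
(their cylindrical radius exceeds `2`). [folklore] -/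
theorem norm_ne_apply_two_of_mem_torus {x : E3}
    (hx : x ∈ {x : E3 | dist (Real.sqrt (‖x - 0‖ ^ 2 - (inner ℝ (x - 0) (EuclideanSpace.single 2 1 : E3)) ^ 2 /
        ‖(EuclideanSpace.single 2 1 : E3)‖ ^ 2), inner ℝ (x - 0) (EuclideanSpace.single 2 1 : E3) /
        ‖(EuclideanSpace.single 2 1 : E3)‖) ((3 : ℝ), (4 : ℝ)) < 1}) : ‖x‖ ≠ x 2 := by
  intro heq
  rw [Set.mem_setOf_eq, Prod.dist_eq, sub_zero] at hx
  have h1 := (max_lt_iff.1 hx).1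
  have hi : inner ℝ x (EuclideanSpace.single 2 1 : E3) = x 2 := by
    rw [EuclideanSpace.inner_single_right]; simp
  have hn1 : ‖(EuclideanSpace.single 2 1 : E3)‖ = 1 := by simp
  rw [hi, hn1, heq, one_pow, div_one, sub_self, Real.sqrt_zero, Real.dist_eq] at h1
  norm_num at h1

/-- **V♯, clause «analytic δv» for the explicit witness, on `landauTorus`.** [folklore] -/
theorem analyticOnNhd_witness_torus :
    AnalyticOnNhd ℝ (fun y : E3 =>
      gradient (fun y : E3 => (y 0 ^ 2 - y 1 ^ 2) * (10 * ‖y‖ - 8 * y 2) / ((‖y‖ - y 2) ^ 2 * (2 * ‖y‖ - y 2))) y +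
        (6 * ((y 0 ^ 2 - y 1 ^ 2) * (10 * ‖y‖ - 8 * y 2) / ((‖y‖ - y 2) ^ 2 * (2 * ‖y‖ - y 2))) / (2 * ‖y‖ - y 2) ^ 2) • y)
      {x : E3 | dist (Real.sqrt (‖x - 0‖ ^ 2 - (inner ℝ (x - 0) (EuclideanSpace.single 2 1 : E3)) ^ 2 /
        ‖(EuclideanSpace.single 2 1 : E3)‖ ^ 2), inner ℝ (x - 0) (EuclideanSpace.single 2 1 : E3) /
        ‖(EuclideanSpace.single 2 1 : E3)‖) ((3 : ℝ), (4 : ℝ)) < 1} :=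
  fun _ hx => analyticAt_witness (norm_ne_apply_two_of_mem_torus hx)

/-- **V♯, clause «analytic δp» for the explicit witness, on `landauTorus`.** [folklore] -/
theorem analyticOnNhd_witnessPressure_torus :
    AnalyticOnNhd ℝ (fun y : E3 =>
      6 * ((y 0 ^ 2 - y 1 ^ 2) * (10 * ‖y‖ - 8 * y 2) / ((‖y‖ - y 2) ^ 2 * (2 * ‖y‖ - y 2))) / (2 * ‖y‖ - y 2) ^ 2 -
        inner ℝ (gradient (fun y : E3 => Real.log (3 * ‖y‖ ^ 2 / (2 * ‖y‖ - y 2) ^ 2)) y)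
          (gradient (fun y : E3 => (y 0 ^ 2 - y 1 ^ 2) * (10 * ‖y‖ - 8 * y 2) / ((‖y‖ - y 2) ^ 2 * (2 * ‖y‖ - y 2))) y))
      {x : E3 | dist (Real.sqrt (‖x - 0‖ ^ 2 - (inner ℝ (x - 0) (EuclideanSpace.single 2 1 : E3)) ^ 2 /
        ‖(EuclideanSpace.single 2 1 : E3)‖ ^ 2), inner ℝ (x - 0) (EuclideanSpace.single 2 1 : E3) /
        ‖(EuclideanSpace.single 2 1 : E3)‖) ((3 : ℝ), (4 : ℝ)) < 1} :=
  fun _ hx => analyticAt_witnessPressure (norm_ne_apply_two_of_mem_torus hx)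

/-- **V♯, clause «unthreaded about the vertex» (`IsUnthreadedOn landauTorus 0 δv`, δ-unfolded) for the explicit witness.** [folklore] -/
theorem isUnthreadedOn_witness_torus :
    ∀ x ∈ {x : E3 | dist (Real.sqrt (‖x - 0‖ ^ 2 - (inner ℝ (x - 0) (EuclideanSpace.single 2 1 : E3)) ^ 2 /
        ‖(EuclideanSpace.single 2 1 : E3)‖ ^ 2), inner ℝ (x - 0) (EuclideanSpace.single 2 1 : E3) /
        ‖(EuclideanSpace.single 2 1 : E3)‖) ((3 : ℝ), (4 : ℝ)) < 1},
      inner ℝ (x - 0) (curl (fun y : E3 =>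
        gradient (fun y : E3 => (y 0 ^ 2 - y 1 ^ 2) * (10 * ‖y‖ - 8 * y 2) / ((‖y‖ - y 2) ^ 2 * (2 * ‖y‖ - y 2))) y +
          (6 * ((y 0 ^ 2 - y 1 ^ 2) * (10 * ‖y‖ - 8 * y 2) / ((‖y‖ - y 2) ^ 2 * (2 * ‖y‖ - y 2))) / (2 * ‖y‖ - y 2) ^ 2) • y)
        x) = 0 :=
  fun _ hx => inner_curl_witness_eq_zero (norm_ne_apply_two_of_mem_torus hx)

end VertexWitness

end Summit.NavierStokesRegularity.NavierStokesRegularity.Theorems.PoloidalLiouville.AzimuthalCartan
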